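import Literature.Computability.QuantumComplexity.PathModelGadgetWords
import Literature.Computability.QuantumComplexity.OneQubitBraidDensity
import HarnessLib

/-!
# The two-qubit gadget sector at `k = 5` generates a dense subgroup of `SU(2)`

Topic `Literature/Computability/QuantumComplexity`. The gadget symbols `M, M⁻¹, M', M'⁻¹`
(`PathModelGadgetSector.lean`, `PathModelGadgetWords.lean`) act on the sector
`span{|enc 11⟩, ℓ'}` by the matrices `π(s) ∈ K5^{2×2}` (basis `(|enc 11⟩, ℓ')`, NOT orthonormal:
`‖ℓ'‖² = ν = 3φ - 4`). They are `ν`-unitary, `π(s)ᴴ diag(1, ν) π(s) = diag(1, ν)` (decided in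
`K5`), so `π̃(s) = D π(s) D⁻¹`, `D = diag(1, √ν)`, are honest unitaries. We verify the
hypotheses of `SU2DensityCriterion.exists_word_near_of_det_eq_one` for the determinant-one pair

  `X = π(M'⁻¹) π(M)`, `Y = π(M') π(M⁻¹)`:

`tr(X)² = (13 - 8φ) det X`, i.e. `μ + μ⁻¹ = 11 - 8φ` whose conjugate `11 - 8ψ ≈ 15.9 > 2`
(golden-ratio test: infinite order); `YX ≠ XY`; `Y X Y⁻¹ ≠ X⁻¹`. Consequence
(`Gadget.exists_XYword_near`): every element of `SU(2)` — in particular `diag(u, ū)` for the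
controlled phases `u = -1, ±i` of `CZ, CS, CS†` — is approximated by `π̃` of a gadget word, which
is the two-qubit half of the universality behind the `PromiseBQP`-hardness of the Jones
polynomial at `k = 5` (Aharonov–Arad 2011 Thm. 3.1, §4).

## References

* D. Aharonov, I. Arad, New J. Phys. 13 (2011) 035019; arXiv:quant-ph/0605181, §3.2, §4
  [AharonovArad2011].
-/

noncomputable section

namespace Literature.Computability.QuantumComplexity

open Matrix Complex Cryptography QuadraticAlgebra

local notation "U2" => Matrix.unitaryGroup (Fin 2) ℂ

namespace Gadget

/-! ### The sector matrices over `K5` -/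

/-- `π(s)` as a `K5` matrix in the basis `(|enc 11⟩, ℓ')` (columns = images). [cite: AharonovArad2011, §3.2] -/
def piMat (s : Sym) : Matrix (Fin 2) (Fin 2) K5 := !![s.pi11, s.pi12; s.pi21, s.pi22]

/-- `ν = ‖ℓ'‖² = 3φ - 4` as an element of `K5`. [cite: AharonovArad2011, §3.2] -/
def nuK : K5 := K5.ofPhi ⟨-4, 3⟩

/-- The Gram matrix `diag(1, ν)` of the basis `(|enc 11⟩, ℓ')`. [cite: AharonovArad2011, §3.2] -/
def gramK : Matrix (Fin 2) (Fin 2) K5 := !![1, 0; 0, nuK]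

/-- **`ν`-unitarity**: `π(s)ᴴ diag(1,ν) π(s) = diag(1,ν)`. [cite: AharonovArad2011, §3.2] -/
theorem piMat_gram (s : Sym) : K5.adjK (piMat s) * gramK * piMat s = gramK := by
  cases s <;> decide +kernel

/-- `X = π(M'⁻¹) π(M)` (the word `M` then `M'⁻¹`). [cite: AharonovArad2011, §4] -/
def X2K : Matrix (Fin 2) (Fin 2) K5 := piMat Sym.M'inv * piMat Sym.M
/-- `X⁻¹ = π(M⁻¹) π(M')`. [cite: AharonovArad2011, §4] -/
def X2invK : Matrix (Fin 2) (Fin 2) K5 := piMat Sym.Minv * piMat Sym.M'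
/-- `Y = π(M') π(M⁻¹)` (the word `M⁻¹` then `M'`). [cite: AharonovArad2011, §4] -/
def Y2K : Matrix (Fin 2) (Fin 2) K5 := piMat Sym.M' * piMat Sym.Minv
/-- `Y⁻¹ = π(M) π(M'⁻¹)`. [cite: AharonovArad2011, §4] -/
def Y2invK : Matrix (Fin 2) (Fin 2) K5 := piMat Sym.M * piMat Sym.M'inv

/-- `X X⁻¹ = 1`. [cite: AharonovArad2011, §4] -/
theorem X2K_mul_inv : X2K * X2invK = 1 := by decide +kernel
/-- `X⁻¹ X = 1`. [cite: AharonovArad2011, §4] -/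
theorem X2invK_mul : X2invK * X2K = 1 := by decide +kernel
/-- `Y Y⁻¹ = 1`. [cite: AharonovArad2011, §4] -/
theorem Y2K_mul_inv : Y2K * Y2invK = 1 := by decide +kernel
/-- `Y⁻¹ Y = 1`. [cite: AharonovArad2011, §4] -/
theorem Y2invK_mul : Y2invK * Y2K = 1 := by decide +kernel
/-- `det X = 1`. [cite: AharonovArad2011, §4] -/
theorem X2K_det : X2K.det = 1 := by decide +kernel
/-- `det Y = 1`. [cite: AharonovArad2011, §4] -/
theorem Y2K_det : Y2K.det = 1 := by decide +kernel
/-- `X` is `ν`-unitary. [cite: AharonovArad2011, §4] -/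
theorem X2K_gram : K5.adjK X2K * gramK * X2K = gramK := by decide +kernel
/-- `Y` is `ν`-unitary. [cite: AharonovArad2011, §4] -/
theorem Y2K_gram : K5.adjK Y2K * gramK * Y2K = gramK := by decide +kernel
/-- **`tr(X)² = (13 - 8φ) det X`** (`μ + μ⁻¹ = 11 - 8φ`). [cite: AharonovArad2011, §4] -/
theorem X2K_trace_sq : X2K.trace * X2K.trace = (2 + K5.ofPhi ⟨11, -8⟩) * X2K.det := by decide +kernel
/-- `Y X ≠ X Y`. [cite: AharonovArad2011, §4] -/
theorem Y2K_mul_X2K_ne : Y2K * X2K ≠ X2K * Y2K := by decide +kernel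
/-- `Y X Y⁻¹ ≠ X⁻¹`. [cite: AharonovArad2011, §4] -/
theorem Y2K_conj_X2K_ne : Y2K * X2K * Y2invK ≠ X2invK := by decide +kernel

/-! ### Unitarisation `π̃ = D π D⁻¹`, `D = diag(1, √ν)` -/

/-- `ν = 3φ - 4 > 0`. [folklore] -/
theorem nu_pos : 0 < ZPhi.toReal ⟨-4, 3⟩ := by
  rw [ZPhi.toReal_apply]
  change (0 : ℝ) < ((-4 : ℤ) : ℝ) + ((3 : ℤ) : ℝ) * Real.goldenRatio
  push_cast
  have : (4 : ℝ) / 3 < Real.goldenRatio := by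
    rw [Real.goldenRatio]
    have h : (5 : ℝ) / 3 < Real.sqrt 5 := by rw [Real.lt_sqrt (by norm_num)]; norm_num
    linarith
  linarith

/-- `√ν`. [folklore] -/
def sqrtNu : ℝ := Real.sqrt (ZPhi.toReal ⟨-4, 3⟩)

/-- `√ν > 0`. [folklore] -/
theorem sqrtNu_pos : 0 < sqrtNu := Real.sqrt_pos.2 nu_pos

/-- `√ν · √ν = ν`. [folklore] -/
theorem sqrtNu_mul_self : sqrtNu * sqrtNu = ZPhi.toReal ⟨-4, 3⟩ := Real.mul_self_sqrt nu_pos.le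

/-- `D = diag(1, √ν)`. [folklore] -/
def dMat : Matrix (Fin 2) (Fin 2) ℂ := !![1, 0; 0, (sqrtNu : ℂ)]

/-- `D⁻¹ = diag(1, 1/√ν)`. [folklore] -/
def dInv : Matrix (Fin 2) (Fin 2) ℂ := !![1, 0; 0, ((sqrtNu : ℂ))⁻¹]

/-- `D⁻¹ D = 1`. [folklore] -/
theorem dInv_mul_dMat : dInv * dMat = 1 := by
  have h : (sqrtNu : ℂ) ≠ 0 := by exact_mod_cast sqrtNu_pos.ne'
  unfold dInv dMat
  rw [Matrix.mul_fin_two, Matrix.one_fin_two]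
  simp [h]

/-- `D D⁻¹ = 1`. [folklore] -/
theorem dMat_mul_dInv : dMat * dInv = 1 := by
  have h : (sqrtNu : ℂ) ≠ 0 := by exact_mod_cast sqrtNu_pos.ne'
  unfold dInv dMat
  rw [Matrix.mul_fin_two, Matrix.one_fin_two]
  simp [h]

/-- `Dᴴ = D`, `D D = diag(1, ν) = gramK` over `ℂ`. [folklore] -/
theorem star_dMat_mul_dMat : star dMat * dMat = gramK.map K5.toComplex := by
  unfold dMat gramK nuK
  rw [star_fin_two, Matrix.mul_fin_two]
  ext i j
  fin_cases i <;> fin_cases j <;> simp [K5.toComplex_ofPhi, Complex.conj_ofReal]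
  rw [← Complex.ofReal_mul, sqrtNu_mul_self]

/-- `diag(1, ν)` over `ℂ`. [folklore] -/
theorem map_gramK : gramK.map K5.toComplex = !![1, 0; 0, (sqrtNu : ℂ) * (sqrtNu : ℂ)] := by
  rw [← Complex.ofReal_mul, sqrtNu_mul_self]
  unfold gramK nuK
  ext i j
  fin_cases i <;> fin_cases j <;> simp [K5.toComplex_ofPhi]

/-- `D⁻¹ᴴ = D⁻¹` and `D⁻¹ diag(1,ν) D⁻¹ = 1`. [folklore] -/
theorem star_dInv_mul_gram_mul_dInv : star dInv * gramK.map K5.toComplex * dInv = 1 := by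
  have h : (sqrtNu : ℂ) ≠ 0 := by exact_mod_cast sqrtNu_pos.ne'
  rw [map_gramK]
  unfold dInv
  rw [star_fin_two, Matrix.mul_fin_two, Matrix.mul_fin_two, Matrix.one_fin_two]
  have hs : (starRingEnd ℂ) ((sqrtNu : ℂ)⁻¹) = ((sqrtNu : ℂ))⁻¹ := by
    rw [map_inv₀, Complex.conj_ofReal]
  simp only [hs, map_one, map_zero]
  ext i j
  fin_cases i <;> fin_cases j <;> simp [h]

/-- **The unitarisation** `π̃ = D π D⁻¹`. [cite: AharonovArad2011, §3.2] -/
def tildeOf (P : Matrix (Fin 2) (Fin 2) K5) : Matrix (Fin 2) (Fin 2) ℂ := dMat * P.map K5.toComplex * dInv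

/-- `π̃` is multiplicative. [folklore] -/
theorem tildeOf_mul (P Q : Matrix (Fin 2) (Fin 2) K5) : tildeOf (P * Q) = tildeOf P * tildeOf Q := by
  unfold tildeOf
  rw [K5.map_mulK]
  calc dMat * (P.map K5.toComplex * Q.map K5.toComplex) * dInv
      = dMat * P.map K5.toComplex * (dInv * dMat) * Q.map K5.toComplex * dInv := by
        rw [dInv_mul_dMat]; simp [Matrix.mul_assoc]
    _ = dMat * P.map K5.toComplex * dInv * (dMat * Q.map K5.toComplex * dInv) := by
        simp [Matrix.mul_assoc]

/-- `π̃(1) = 1`. [folklore] -/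
theorem tildeOf_one : tildeOf 1 = 1 := by
  unfold tildeOf; rw [Matrix.map_one K5.toComplex (map_zero _) (map_one _), Matrix.mul_one, dMat_mul_dInv]

/-- `π̃` is injective. [folklore] -/
theorem tildeOf_injective {P Q : Matrix (Fin 2) (Fin 2) K5} (h : tildeOf P = tildeOf Q) : P = Q := by
  apply K5.map_injective
  have e : dInv * tildeOf P * dMat = dInv * tildeOf Q * dMat := by rw [h]
  unfold tildeOf at e
  have key : ∀ R : Matrix (Fin 2) (Fin 2) ℂ, dInv * (dMat * R * dInv) * dMat = R := fun R => by
    calc dInv * (dMat * R * dInv) * dMat = (dInv * dMat) * R * (dInv * dMat) := by simp [Matrix.mul_assoc]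
      _ = R := by rw [dInv_mul_dMat, Matrix.one_mul, Matrix.mul_one]
  rwa [key, key] at e

/-- **`ν`-unitary matrices unitarise**: if `Pᴴ diag(1,ν) P = diag(1,ν)` then `π̃(P) ∈ U(2)`.
[cite: AharonovArad2011, §3.2] -/
theorem tildeOf_mem_unitaryGroup {P : Matrix (Fin 2) (Fin 2) K5} (h : K5.adjK P * gramK * P = gramK) :
    tildeOf P ∈ U2 := by
  rw [Matrix.mem_unitaryGroup_iff']
  unfold tildeOf
  have hmap : star (P.map K5.toComplex) * gramK.map K5.toComplex * P.map K5.toComplex = gramK.map K5.toComplex := by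
    rw [← K5.map_adjK, ← K5.map_mulK, ← K5.map_mulK, h]
  calc star (dMat * P.map K5.toComplex * dInv) * (dMat * P.map K5.toComplex * dInv)
      = star dInv * (star (P.map K5.toComplex) * (star dMat * dMat) * P.map K5.toComplex) * dInv := by
        rw [star_mul, star_mul]; simp [Matrix.mul_assoc]
    _ = star dInv * gramK.map K5.toComplex * dInv := by rw [star_dMat_mul_dMat, hmap]
    _ = 1 := star_dInv_mul_gram_mul_dInv

/-- Trace is invariant under unitarisation. [folklore] -/
theorem trace_tildeOf (P : Matrix (Fin 2) (Fin 2) K5) : (tildeOf P).trace = K5.toComplex P.trace := by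
  unfold tildeOf
  rw [Matrix.trace_mul_cycle, dInv_mul_dMat, Matrix.one_mul, K5.trace_mapK]

/-- Determinant is invariant under unitarisation. [folklore] -/
theorem det_tildeOf (P : Matrix (Fin 2) (Fin 2) K5) : (tildeOf P).det = K5.toComplex P.det := by
  unfold tildeOf
  rw [det_mul, det_mul, K5.det_mapK, mul_comm (dMat.det), mul_assoc, ← det_mul, dMat_mul_dInv, det_one, mul_one]

/-! ### The density -/

/-- `X̃ ∈ U(2)`. [cite: AharonovArad2011, §4] -/
def X2U : U2 := ⟨tildeOf X2K, tildeOf_mem_unitaryGroup X2K_gram⟩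

/-- `Ỹ ∈ U(2)`. [cite: AharonovArad2011, §4] -/
def Y2U : U2 := ⟨tildeOf Y2K, tildeOf_mem_unitaryGroup Y2K_gram⟩

/-- `det X̃ = 1`. [cite: AharonovArad2011, §4] -/
theorem X2U_det : (X2U : Matrix (Fin 2) (Fin 2) ℂ).det = 1 := by
  change (tildeOf X2K).det = 1; rw [det_tildeOf, X2K_det, map_one]

/-- `det Ỹ = 1`. [cite: AharonovArad2011, §4] -/
theorem Y2U_det : (Y2U : Matrix (Fin 2) (Fin 2) ℂ).det = 1 := by
  change (tildeOf Y2K).det = 1; rw [det_tildeOf, Y2K_det, map_one]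

/-- For a unitary `π̃(P)` with `P Q = 1`, the adjoint is `π̃(Q)`. [folklore] -/
theorem star_tildeOf_eq {P Q : Matrix (Fin 2) (Fin 2) K5} (hP : tildeOf P ∈ U2) (hPQ : P * Q = 1) :
    star (tildeOf P) = tildeOf Q := by
  have h1 : tildeOf P * tildeOf Q = 1 := by rw [← tildeOf_mul, hPQ, tildeOf_one]
  have h2 : tildeOf P * star (tildeOf P) = 1 := Matrix.mem_unitaryGroup_iff.1 hP
  calc star (tildeOf P) = star (tildeOf P) * (tildeOf P * tildeOf Q) := by rw [h1, Matrix.mul_one]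
    _ = (star (tildeOf P) * tildeOf P) * tildeOf Q := by rw [Matrix.mul_assoc]
    _ = tildeOf Q := by rw [Matrix.mem_unitaryGroup_iff'.1 hP, Matrix.one_mul]

/-- The conjugate of `11 - 8φ` is `11 - 8ψ > 2`. [folklore] -/
theorem two_lt_toConj_eleven : 2 < ZPhi.toConj ⟨11, -8⟩ := by
  rw [ZPhi.toConj_apply]
  change (2 : ℝ) < ((11 : ℤ) : ℝ) + ((-8 : ℤ) : ℝ) * Real.goldenConj
  push_cast
  linarith [Real.goldenConj_neg]

section Density

open scoped Matrix.Norms.L2Operator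

/-- **Density of the two-qubit gadget sector (criterion form)**: every `A ∈ SU(2)` is
approximated in operator norm by words in `X̃, Ỹ, X̃⁻¹, Ỹ⁻¹`. [cite: AharonovArad2011, §4] -/
theorem exists_XYword_near (A : U2) (hA : (A : Matrix (Fin 2) (Fin 2) ℂ).det = 1) {ε : ℝ} (hε : 0 < ε) :
    ∃ w : List U2, (∀ x ∈ w, x ∈ ({X2U, Y2U, X2U⁻¹, Y2U⁻¹} : Set U2)) ∧
      ‖((w.prod : U2) : Matrix (Fin 2) (Fin 2) ℂ) - (A : Matrix (Fin 2) (Fin 2) ℂ)‖ < ε := by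
  refine exists_word_near_of_det_eq_one X2U Y2U (K5.toComplex (2 + K5.ofPhi ⟨11, -8⟩)) ?_ ?_ ?_ ?_ A hA hε
  · change (tildeOf X2K).trace ^ 2 = _ * (tildeOf X2K).det
    rw [trace_tildeOf, det_tildeOf, sq, ← map_mul, ← map_mul, X2K_trace_sq]
  · intro μ hμ m hm
    refine pow_ne_one_of_add_inv_eq_toReal (c := ⟨11, -8⟩) ?_ two_lt_toConj_eleven hm
    rw [hμ, map_add, K5.toComplex_ofPhi, map_ofNat]; ring
  · intro h
    have e := congrArg (fun U : U2 => (U : Matrix (Fin 2) (Fin 2) ℂ)) h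
    simp only [Submonoid.coe_mul] at e
    change tildeOf Y2K * tildeOf X2K = tildeOf X2K * tildeOf Y2K at e
    rw [← tildeOf_mul, ← tildeOf_mul] at e
    exact Y2K_mul_X2K_ne (tildeOf_injective e)
  · intro h
    rw [X2U_det, one_smul] at h
    change tildeOf Y2K * tildeOf X2K * star (tildeOf Y2K) = star (tildeOf X2K) at h
    rw [star_tildeOf_eq Y2U.2 Y2K_mul_inv, star_tildeOf_eq X2U.2 X2K_mul_inv, ← tildeOf_mul, ← tildeOf_mul] at h
    exact Y2K_conj_X2K_ne (tildeOf_injective h)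

end Density

end Gadget

end Literature.Computability.QuantumComplexity

end
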